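import Mathlib.Data.Nat.Bitwise
import Mathlib.Logic.Equiv.Defs
import Mathlib.GroupTheory.Perm.Basic
import Literature.Computability.QuantumComplexity.SinkOfVerifiableLine
import Literature.Computability.Complexity.BlockSensitivity
import HarnessLib

/-!
# Merge-free SINK-OF-VERIFIABLE-LINE instances, relabelling of names, horizon truncation

A sequel to `SinkOfVerifiableLine.lean` (black-box SVL in the Boolean query model: inputs
`t : SVLInput m T` = the table of `S : {0,1}ᵐ → {0,1}ᵐ` followed by the table of
`V : {0,1}ᵐ × {0, …, T} → {0,1}`, promise `svlPromise m T` = "there is a verifiable line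
`xs : x₀ = 0ᵐ, x₁, …, x_T`", `IsSvlLine t xs`). This file adds the finite objects used by the
hybrid / coupling arguments on this problem (crux `WbwVerifiableLineNoSpeedup` of route
`QuantumAdvantage/WhiteBoxWalk`, line `transposition-coupling-reduction`, whose §0 mirrored these
definitions verbatim; the short names and bodies below are the mirror's):

* `mergeFreeSet m T : Finset (SVLInput m T)` — the MERGE-FREE inputs: `t` has a verifiable line
  `xs` and the successor of every name off the line `x₀, …, x_{T-1}` (i.e. of every off-line name
  and of the sink `x_T`) lies OFF the line. This is the combinatorial shape of the hard SVL
  distribution of Bitansky–Paneth–Rosen [BitanskyPanethRosen2015, §5.2–5.3, Fig. 1–2]: there the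
  successor circuit is an obfuscated verify-and-sign circuit which maps every name `(i, σ)` with a
  wrong signature to the canonical string `⊥` and the sink `(T, σ_T)` to `SOLVED`, so that the
  line vertices `x₁, …, x_T` have in-degree one (from their predecessor) and nothing else walks
  into the line. Read in the black-box model (tables instead of circuits, arbitrary names), the
  set of ALL inputs of this shape is `mergeFreeSet`; the uniform distribution on it is the hard
  distribution of the crux line. API: `mem_mergeFreeSet`, `mergeFreeSet_subset_svlPromise`,
  the explicit member `svlInput m T (svlCappedSucc h) [x = i]` (`svlInput_capped_mem_mergeFreeSet`),
  `mergeFreeSet_nonempty_iff : (mergeFreeSet m T).Nonempty ↔ T + 2 ≤ 2ᵐ`.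
* `svlRelabel τ t` — relabelling the names by a permutation `τ` of `{0,1}ᵐ`:
  `S ↦ τ ∘ S ∘ τ⁻¹`, `V(x, i) ↦ V(τ⁻¹ x, i)` (an action of `Equiv.Perm (Fin (2ᵐ))` on inputs:
  `svlRelabel_one`, `svlRelabel_mul`). A relabelling fixing the source `0ᵐ` carries the line `xs`
  to `τ ∘ xs` (`IsSvlLine.relabel`) and preserves the promise and the merge-free set
  (`svlRelabel_mem_svlPromise`, `svlRelabel_mem_mergeFreeSet`); with `τ` the transposition
  `(x_T, x_T ⊕ 1)` it flips the sink bit (`IsSvlLine.svlSinkBit_svlRelabel`, `flipLow`).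
* `flipLow x` — the name `x ⊕ 1` (low-order bit flipped): an involution changing the parity
  (`flipLow_flipLow`, `flipLow_val_mod_two_ne`, both for `1 ≤ m`).
* `horizonInput h t` — the HORIZON-TRUNCATED input: the `S`-table of `t` and its `V`-cells of level
  `i ≤ h` are kept, every `V`-cell of level `i > h` reads `false` (`svlSucc_horizonInput`,
  `svlVerify_horizonInput`). On the promise set with line `xs` this is `t` with the block of the
  `T - h` hidden marked cells `(x_i, i)`, `i > h`, flipped (`IsSvlLine.horizonInput_eq_flipBlock`,
  `flipBlock` of `BlockSensitivity.lean`), the form in which the hybrid bound of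
  Bennett–Bernstein–Brassard–Vazirani (`QueryHybridBound.lean`) consumes it; relabelling commutes
  with truncation (`horizonInput_svlRelabel`).
* Index bookkeeping: every input position is an `S`-bit position `svlSuccIndex m T x j` or a
  `V`-cell `svlVerifyIndex m T x i`, never both (`eq_svlSuccIndex_or_eq_svlVerifyIndex`,
  `svlSuccIndex_ne_svlVerifyIndex`, `svlVerifyIndex_inj`), and re-encoding the decoded tables gives
  the input back (`svlInput_svlSucc_svlVerify`).

What is NOT here: the time-dependent ("moving horizon") run of a query algorithm
(`stateAtSched`, and `horizonState A t s := stateAtSched A (fun r => horizonInput (r + 2) t) s`),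
which belongs with `QueryHybridBound.lean`; any probability estimate on `mergeFreeSet` (the
guessing lemmas of the crux line); BPR's cryptographic instantiation (iO, puncturable PRFs).
Mathlib has none of this vocabulary (searched `mergeFree`, `VerifiableLine`, `flipLow`,
`horizonInput`); we reuse
`Equiv.Perm`, `Equiv.swap`, `Nat.xor_lt_two_pow`, `Nat.xor_mod_two_eq`, `Fin.addCases`.

## References

* N. Bitansky, O. Paneth, A. Rosen, *On the cryptographic hardness of finding a Nash
  equilibrium*, FOCS 2015, Def. 2.2 (p. 6), §5.2–5.3 with Fig. 1–2 (pp. 11–12)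
  [BitanskyPanethRosen2015].
* C. H. Bennett, E. Bernstein, G. Brassard, U. Vazirani, *Strengths and weaknesses of quantum
  computing*, SIAM J. Comput. 26 (1997), Thm. 3.3 [BennettBernsteinBrassardVazirani1997].
-/

namespace Literature.Computability.QuantumComplexity

open Complexity Cryptography Finset

section MergeFree

variable {m T : ℕ}

/-! ### Index bookkeeping -/

/-- Two `V`-cells coincide iff they have the same name and the same level. [folklore] -/
theorem svlVerifyIndex_inj {x x' : Fin (2 ^ m)} {i i' : Fin (T + 1)} :
    svlVerifyIndex m T x i = svlVerifyIndex m T x' i' ↔ x = x' ∧ i = i' := by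
  constructor
  · intro h
    have h' := Fin.natAdd_injective _ _ h
    simpa [Prod.ext_iff] using h'
  · rintro ⟨rfl, rfl⟩
    rfl

/-- Two `S`-bit positions coincide iff they have the same name and the same bit index. [folklore] -/
theorem svlSuccIndex_inj {x x' : Fin (2 ^ m)} {j j' : Fin m} :
    svlSuccIndex m T x j = svlSuccIndex m T x' j' ↔ x = x' ∧ j = j' := by
  constructor
  · intro h
    have h' := Fin.castAdd_injective _ _ h
    simpa [Prod.ext_iff] using h'
  · rintro ⟨rfl, rfl⟩
    rfl

/-- An `S`-bit position is never a `V`-cell (the two tables occupy disjoint ranges). [folklore] -/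
theorem svlSuccIndex_ne_svlVerifyIndex (x : Fin (2 ^ m)) (j : Fin m) (x' : Fin (2 ^ m))
    (i : Fin (T + 1)) : svlSuccIndex m T x j ≠ svlVerifyIndex m T x' i := by
  intro h
  have h' := congrArg Fin.val h
  simp only [svlSuccIndex, svlVerifyIndex, Fin.val_castAdd, Fin.val_natAdd] at h'
  have := (finProdFinEquiv (x, j)).isLt
  omega

/-- Every input position is either an `S`-bit position or a `V`-cell. [folklore] -/
theorem eq_svlSuccIndex_or_eq_svlVerifyIndex (k : Fin (2 ^ m * m + 2 ^ m * (T + 1))) :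
    (∃ x : Fin (2 ^ m), ∃ j : Fin m, k = svlSuccIndex m T x j) ∨
      ∃ x : Fin (2 ^ m), ∃ i : Fin (T + 1), k = svlVerifyIndex m T x i := by
  induction k using Fin.addCases with
  | left k =>
      refine Or.inl ⟨(finProdFinEquiv.symm k).1, (finProdFinEquiv.symm k).2, ?_⟩
      simp only [svlSuccIndex, Prod.mk.eta, Equiv.apply_symm_apply]
  | right k =>
      refine Or.inr ⟨(finProdFinEquiv.symm k).1, (finProdFinEquiv.symm k).2, ?_⟩
      simp only [svlVerifyIndex, Prod.mk.eta, Equiv.apply_symm_apply]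

/-- The input bit at a `V`-cell is the verifier bit (unfolding lemma). [folklore] -/
theorem apply_svlVerifyIndex (t : SVLInput m T) (x : Fin (2 ^ m)) (i : Fin (T + 1)) :
    t (svlVerifyIndex m T x i) = svlVerify t x i := rfl

/-- The input bit at an `S`-bit position is the successor bit (unfolding lemma). [folklore] -/
theorem apply_svlSuccIndex (t : SVLInput m T) (x : Fin (2 ^ m)) (j : Fin m) :
    t (svlSuccIndex m T x j) = svlSuccBit t x j := rfl

/-- Bit `j` of the decoded successor `svlSucc t x` is the table bit `svlSuccBit t x j`. [folklore] -/
theorem testBit_svlSucc (t : SVLInput m T) (x : Fin (2 ^ m)) (j : Fin m) :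
    (svlSucc t x).val.testBit j.val = svlSuccBit t x j := by
  have h := svlBits_symm_apply (m := m) (svlSuccBit t x)
  exact congrFun h j

/-- Round trip: re-encoding the decoded tables `(svlSucc t, svlVerify t)` gives back the input `t`.
[folklore] -/
theorem svlInput_svlSucc_svlVerify (t : SVLInput m T) : svlInput m T (svlSucc t) (svlVerify t) = t := by
  funext k
  rcases eq_svlSuccIndex_or_eq_svlVerifyIndex k with ⟨x, j, rfl⟩ | ⟨x, i, rfl⟩
  · show svlSuccBit (svlInput m T (svlSucc t) (svlVerify t)) x j = svlSuccBit t x j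
    rw [svlSuccBit_svlInput, testBit_svlSucc]
  · show svlVerify (svlInput m T (svlSucc t) (svlVerify t)) x i = svlVerify t x i
    rw [svlVerify_svlInput]

/-- Two inputs with the same decoded tables are equal. [folklore] -/
theorem SVLInput.ext_tables {t t' : SVLInput m T} (hS : ∀ x, svlSucc t x = svlSucc t' x)
    (hV : ∀ x i, svlVerify t x i = svlVerify t' x i) : t = t' := by
  rw [← svlInput_svlSucc_svlVerify t, ← svlInput_svlSucc_svlVerify t']
  congr 1
  · exact funext hS
  · exact funext fun x => funext (hV x)

/-! ### Merge-free inputs -/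

open scoped Classical in
/-- The finite set `J′` of MERGE-FREE SVL inputs with parameters `m, T`: `t = (S, V)` has a
verifiable line `xs = (x₀ = 0ᵐ, …, x_T)` (so `t ∈ svlPromise m T`) AND the successor `S(y)` of
every name `y ∉ {x₀, …, x_{T-1}}` — every off-line name and the sink `x_T` — lies off the line.
Equivalently: the line vertices `x₁, …, x_T` have in-degree exactly one in the functional graph of
`S` (from their predecessor), and no walk from outside ever enters the line. This is the shape of
the hard SVL distribution of Bitansky–Paneth–Rosen, whose successor circuit (the obfuscated
verify-and-sign circuit `VS` of Fig. 1) sends every name `(i, σ)` with `σ ≠ PRF_S(i)` to `⊥` and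
the sink `(T, σ_T)` to `SOLVED` (Fig. 2) — with the canonical strings `⊥`, `SOLVED` off the line,
nothing but `x_{i-1}` walks into `x_i` — read in the black-box model of
`SinkOfVerifiableLine.lean` (tables for circuits, arbitrary names, source `0ᵐ`); the uniform
distribution on `mergeFreeSet m T` (uniform injective line through `0ᵐ`, independent uniform
off-line successors avoiding the line) is the hard distribution used against quantum query
algorithms. Differences from the printed sampler, recorded rather than hidden: BPR fix ONE
canonical off-line value `⊥` (and `SOLVED` for the sink), here any off-line values are allowed;
BPR's names carry their index `i`, here names are arbitrary (a relabelling, `svlRelabel`).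
Membership is decided classically. [cite: BitanskyPanethRosen2015, §5.2–5.3, Fig. 1–2 (pp. 11–12)] -/
noncomputable def mergeFreeSet (m T : ℕ) : Finset (SVLInput m T) :=
  Finset.univ.filter fun t => ∃ xs : Fin (T + 1) → Fin (2 ^ m), IsSvlLine t xs ∧
    ∀ y : Fin (2 ^ m), (∀ i : Fin T, y ≠ xs i.castSucc) → ∀ i : Fin (T + 1), svlSucc t y ≠ xs i

/-- Membership in `mergeFreeSet`: a verifiable line such that the successor of every name not among
`x₀, …, x_{T-1}` is off the line. [cite: BitanskyPanethRosen2015, §5.2–5.3, Fig. 1–2 (pp. 11–12)] -/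
theorem mem_mergeFreeSet {t : SVLInput m T} :
    t ∈ mergeFreeSet m T ↔ ∃ xs : Fin (T + 1) → Fin (2 ^ m), IsSvlLine t xs ∧
      ∀ y : Fin (2 ^ m), (∀ i : Fin T, y ≠ xs i.castSucc) →
        ∀ i : Fin (T + 1), svlSucc t y ≠ xs i := by
  simp [mergeFreeSet]

/- `mergeFreeSet m T` is a `Finset.filter` of `Finset.univ` over the function type
`SVLInput m T`. At CONCRETE parameters, elaborating a declaration whose statement or hypotheses
contain a membership `t ∈ mergeFreeSet 3 2` makes Lean unfold the set (`whnf`) through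
`Finset.univ` of the function type, deeper than `maxRecDepth` already at input length `48`
(`m = 3, T = 2`; `m = 2` still passes). The set is never meant to be enumerated: we make the
definition irreducible right after its membership lemma and work through `mem_mergeFreeSet`
(symbolic `m, T`, the only case used downstream, are unaffected either way). -/
attribute [irreducible] mergeFreeSet

/-- `J′ ⊆ svlPromise`: merge-free inputs satisfy the SVL promise. [cite: BitanskyPanethRosen2015, §5.3 (p. 12), "I is an SVL sampler"] -/
theorem mergeFreeSet_subset_svlPromise :
    (↑(mergeFreeSet m T) : Set (SVLInput m T)) ⊆ svlPromise m T := by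
  intro t ht
  obtain ⟨xs, hxs⟩ := mem_mergeFreeSet.1 (Finset.mem_coe.1 ht)
  exact ⟨xs, hxs.1⟩

/-- The CAPPED successor table: `x ↦ x + 1` for `x < T`, and every other name (the sink `T` and the
off-line names `> T`) `↦ T + 1`, an off-line name (requires `T + 2 ≤ 2ᵐ`). With the straight line
`0, 1, …, T` this is the black-box picture of BPR's Fig. 2 (`⊥ = SOLVED = T + 1`). [cite: BitanskyPanethRosen2015, §5.3, Fig. 2 (p. 12)] -/
def svlCappedSucc (h : T + 2 ≤ 2 ^ m) (x : Fin (2 ^ m)) : Fin (2 ^ m) :=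
  if hx : x.val < T then ⟨x.val + 1, by omega⟩ else ⟨T + 1, by omega⟩

/-- The capped instance (straight line `0, …, T`, everything else `↦ T + 1`, `V(x, i) = [x = i]`)
is merge-free. [cite: BitanskyPanethRosen2015, §5.3, Fig. 2 (p. 12)] -/
theorem svlInput_capped_mem_mergeFreeSet (h : T + 2 ≤ 2 ^ m) :
    svlInput m T (svlCappedSucc h) (fun x i => decide (x.val = i.val)) ∈ mergeFreeSet m T := by
  have hs : T + 1 ≤ 2 ^ m := (Nat.le_succ _).trans h
  refine mem_mergeFreeSet.2 ⟨svlStraightLine hs, ?_, fun y hy i => ?_⟩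
  · rw [isSvlLine_iff]
    refine ⟨fun i j hij => Fin.ext (Fin.mk.inj_iff.1 hij), rfl, fun i => ?_, fun x i => ?_⟩
    · rw [svlSucc_svlInput]
      have hi : (svlStraightLine hs i.castSucc).val < T := by
        simp only [svlStraightLine, Fin.val_castSucc]
        exact i.isLt
      unfold svlCappedSucc
      rw [dif_pos hi]
      apply Fin.ext
      simp [svlStraightLine]
    · rw [svlVerify_svlInput]
      simp [svlStraightLine, Fin.ext_iff]
  · have hyT : ¬ y.val < T := fun hlt =>
      hy ⟨y.val, hlt⟩ (Fin.ext (by simp [svlStraightLine]))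
    rw [svlSucc_svlInput]
    unfold svlCappedSucc
    rw [dif_neg hyT]
    intro heq
    have h1 := congrArg Fin.val heq
    simp only [svlStraightLine] at h1
    have h2 := i.isLt
    omega

/-- `mergeFreeSet m T` is nonempty as soon as `T + 2 ≤ 2ᵐ` (room for the line and one off-line
name). [folklore] -/
theorem mergeFreeSet_nonempty (h : T + 2 ≤ 2 ^ m) : (mergeFreeSet m T).Nonempty :=
  ⟨_, svlInput_capped_mem_mergeFreeSet h⟩

/-- If `2ᵐ < T + 2` there is no merge-free input: either there is no simple line at all, or the
line fills `{0,1}ᵐ` and the successor of the sink is on it. [folklore] -/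
theorem mergeFreeSet_eq_empty (h : 2 ^ m < T + 2) : mergeFreeSet m T = ∅ := by
  refine Finset.eq_empty_of_forall_notMem fun t ht => ?_
  obtain ⟨xs, hxs, hmf⟩ := mem_mergeFreeSet.1 ht
  have hcard : T + 1 ≤ 2 ^ m := by
    simpa using Fintype.card_le_of_injective xs hxs.injective
  have hbij : Function.Bijective xs :=
    (Fintype.bijective_iff_injective_and_card xs).2 ⟨hxs.injective, by
      rw [Fintype.card_fin, Fintype.card_fin]; exact le_antisymm hcard (Nat.lt_succ_iff.1 h)⟩
  obtain ⟨i, hi⟩ := hbij.2 (svlSucc t (xs (Fin.last T)))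
  exact hmf (xs (Fin.last T)) (fun j hj => (Fin.castSucc_lt_last j).ne' (hxs.injective hj)) i
    hi.symm

/-- `mergeFreeSet m T` is nonempty iff `T + 2 ≤ 2ᵐ`. [folklore] -/
theorem mergeFreeSet_nonempty_iff : (mergeFreeSet m T).Nonempty ↔ T + 2 ≤ 2 ^ m := by
  refine ⟨fun hne => ?_, mergeFreeSet_nonempty⟩
  by_contra hlt
  rw [mergeFreeSet_eq_empty (Nat.lt_of_not_le hlt)] at hne
  exact Finset.not_nonempty_empty hne

/-! ### Relabelling the names -/

/-- Relabel the names of the input `t = (S, V)` by the permutation `τ` of `{0,1}ᵐ`: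
the new tables are `S' = τ ∘ S ∘ τ⁻¹` and `V'(x, i) = V(τ⁻¹ x, i)` (the image of the instance
under the renaming `x ↦ τ x` of all vertices). [folklore] -/
noncomputable def svlRelabel (τ : Equiv.Perm (Fin (2 ^ m))) (t : SVLInput m T) : SVLInput m T :=
  svlInput m T (fun x => τ (svlSucc t (τ.symm x))) fun x i => svlVerify t (τ.symm x) i

/-- The successor table of the relabelled input is `τ ∘ S ∘ τ⁻¹`. [folklore] -/
@[simp] theorem svlSucc_svlRelabel (τ : Equiv.Perm (Fin (2 ^ m))) (t : SVLInput m T)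
    (x : Fin (2 ^ m)) : svlSucc (svlRelabel τ t) x = τ (svlSucc t (τ.symm x)) :=
  svlSucc_svlInput _ _ _

/-- The `S`-table bits of the relabelled input. [folklore] -/
@[simp] theorem svlSuccBit_svlRelabel (τ : Equiv.Perm (Fin (2 ^ m))) (t : SVLInput m T)
    (x : Fin (2 ^ m)) (j : Fin m) :
    svlSuccBit (svlRelabel τ t) x j = (τ (svlSucc t (τ.symm x))).val.testBit j.val :=
  svlSuccBit_svlInput _ _ _ _

/-- The verifier table of the relabelled input is `V(τ⁻¹ x, i)`. [folklore] -/
@[simp] theorem svlVerify_svlRelabel (τ : Equiv.Perm (Fin (2 ^ m))) (t : SVLInput m T)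
    (x : Fin (2 ^ m)) (i : Fin (T + 1)) :
    svlVerify (svlRelabel τ t) x i = svlVerify t (τ.symm x) i :=
  svlVerify_svlInput _ _ _ _

/-- Relabelling an encoded pair of tables `(S, V)` gives the encoding of
`(τ ∘ S ∘ τ⁻¹, V(τ⁻¹ ·, ·))`. [folklore] -/
theorem svlRelabel_svlInput (τ : Equiv.Perm (Fin (2 ^ m))) (S : Fin (2 ^ m) → Fin (2 ^ m))
    (V : Fin (2 ^ m) → Fin (T + 1) → Bool) :
    svlRelabel τ (svlInput m T S V) =
      svlInput m T (fun x => τ (S (τ.symm x))) fun x i => V (τ.symm x) i := by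
  simp [svlRelabel]

/-- The identity relabelling does nothing. [folklore] -/
@[simp] theorem svlRelabel_one (t : SVLInput m T) : svlRelabel 1 t = t := by
  simp only [svlRelabel, Equiv.Perm.one_def, Equiv.refl_symm, Equiv.refl_apply]
  exact svlInput_svlSucc_svlVerify t

/-- Relabelling is an action: `(σ τ) · t = σ · (τ · t)`. [folklore] -/
theorem svlRelabel_mul (σ τ : Equiv.Perm (Fin (2 ^ m))) (t : SVLInput m T) :
    svlRelabel (σ * τ) t = svlRelabel σ (svlRelabel τ t) := by
  simp only [svlRelabel, svlSucc_svlInput, svlVerify_svlInput, Equiv.Perm.mul_def,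
    Equiv.trans_apply, Equiv.symm_trans_apply]

/-- `τ⁻¹` undoes `τ`. [folklore] -/
@[simp] theorem svlRelabel_inv_svlRelabel (τ : Equiv.Perm (Fin (2 ^ m))) (t : SVLInput m T) :
    svlRelabel τ⁻¹ (svlRelabel τ t) = t := by
  rw [← svlRelabel_mul, inv_mul_cancel, svlRelabel_one]

/-- `τ` undoes `τ⁻¹`. [folklore] -/
@[simp] theorem svlRelabel_svlRelabel_inv (τ : Equiv.Perm (Fin (2 ^ m))) (t : SVLInput m T) :
    svlRelabel τ (svlRelabel τ⁻¹ t) = t := by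
  rw [← svlRelabel_mul, mul_inv_cancel, svlRelabel_one]

/-- Relabelling by a transposition is an involution. [folklore] -/
theorem svlRelabel_swap_svlRelabel_swap (a b : Fin (2 ^ m)) (t : SVLInput m T) :
    svlRelabel (Equiv.swap a b) (svlRelabel (Equiv.swap a b) t) = t := by
  rw [← svlRelabel_mul, Equiv.swap_mul_self, svlRelabel_one]

/-- Relabelling by a fixed `τ` is injective on inputs. [folklore] -/
theorem svlRelabel_injective (τ : Equiv.Perm (Fin (2 ^ m))) :
    Function.Injective (svlRelabel (T := T) τ) := fun t t' h => by
  rw [← svlRelabel_inv_svlRelabel τ t, h, svlRelabel_inv_svlRelabel]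

/-- A relabelling `τ` fixing the source `0ᵐ` carries a verifiable line `xs` of `t` to the
verifiable line `τ ∘ xs` of `svlRelabel τ t`. [folklore] -/
theorem IsSvlLine.relabel {t : SVLInput m T} {xs : Fin (T + 1) → Fin (2 ^ m)}
    (h : IsSvlLine t xs) (τ : Equiv.Perm (Fin (2 ^ m)))
    (hτ : τ ⟨0, Nat.two_pow_pos m⟩ = ⟨0, Nat.two_pow_pos m⟩) :
    IsSvlLine (svlRelabel τ t) (τ ∘ xs) := by
  rw [isSvlLine_iff] at h ⊢
  obtain ⟨hinj, h0, hS, hV⟩ := h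
  refine ⟨τ.injective.comp hinj, ?_, fun i => ?_, fun x i => ?_⟩
  · have hx0 : xs 0 = ⟨0, Nat.two_pow_pos m⟩ := Fin.ext h0
    show (τ (xs 0)).val = 0
    rw [hx0, hτ]
  · simp [hS i]
  · rw [svlVerify_svlRelabel, hV, Function.comp_apply]
    simp only [Equiv.symm_apply_eq]

/-- A relabelling fixing `0ᵐ` preserves the promise set. [folklore] -/
theorem svlRelabel_mem_svlPromise {t : SVLInput m T} (ht : t ∈ svlPromise m T)
    (τ : Equiv.Perm (Fin (2 ^ m))) (hτ : τ ⟨0, Nat.two_pow_pos m⟩ = ⟨0, Nat.two_pow_pos m⟩) :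
    svlRelabel τ t ∈ svlPromise m T := by
  obtain ⟨xs, hxs⟩ := ht
  exact ⟨τ ∘ xs, hxs.relabel τ hτ⟩

/-- A relabelling fixing `0ᵐ` maps the merge-free set to itself. [folklore] -/
theorem svlRelabel_mem_mergeFreeSet {t : SVLInput m T} (ht : t ∈ mergeFreeSet m T)
    (τ : Equiv.Perm (Fin (2 ^ m))) (hτ : τ ⟨0, Nat.two_pow_pos m⟩ = ⟨0, Nat.two_pow_pos m⟩) :
    svlRelabel τ t ∈ mergeFreeSet m T := by
  obtain ⟨xs, hxs, hmf⟩ := mem_mergeFreeSet.1 ht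
  refine mem_mergeFreeSet.2 ⟨τ ∘ xs, hxs.relabel τ hτ, fun y hy i => ?_⟩
  rw [svlSucc_svlRelabel, Function.comp_apply, ne_eq, τ.apply_eq_iff_eq]
  exact hmf (τ.symm y)
    (fun j hj => hy j (by rw [Function.comp_apply, ← hj, Equiv.apply_symm_apply])) i

/-- The relabelled sink bit: with line `xs` and `τ` fixing `0ᵐ`, the SVL bit of `svlRelabel τ t` is
the parity of `τ x_T`. [folklore] -/
theorem IsSvlLine.svlSinkBit_svlRelabel {t : SVLInput m T} {xs : Fin (T + 1) → Fin (2 ^ m)}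
    (h : IsSvlLine t xs) (τ : Equiv.Perm (Fin (2 ^ m)))
    (hτ : τ ⟨0, Nat.two_pow_pos m⟩ = ⟨0, Nat.two_pow_pos m⟩) :
    svlSinkBit m T (svlRelabel τ t) = decide ((τ (xs (Fin.last T))).val % 2 = 1) :=
  (h.relabel τ hτ).svlSinkBit_eq

/-! ### Flipping the low-order bit of a name -/

/-- Flip the low-order bit of a name: `x ↦ x ⊕ 1` (the partner of the sink in the sink-flip
coupling; `% 2ᵐ` is a no-op for `1 ≤ m` (`flipLow_val`) and a harmless junk value `0` for
`m = 0`). [folklore] -/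
def flipLow (x : Fin (2 ^ m)) : Fin (2 ^ m) :=
  ⟨(x.val ^^^ 1) % 2 ^ m, Nat.mod_lt _ (Nat.two_pow_pos m)⟩

/-- For `1 ≤ m`, `flipLow x = x ⊕ 1` with no reduction. [folklore] -/
theorem flipLow_val (hm : 1 ≤ m) (x : Fin (2 ^ m)) : (flipLow x).val = x.val ^^^ 1 :=
  Nat.mod_eq_of_lt (Nat.xor_lt_two_pow x.isLt (Nat.one_lt_two_pow (by omega)))

/-- `flipLow` is an involution (`1 ≤ m`). [folklore] -/
@[simp] theorem flipLow_flipLow (hm : 1 ≤ m) (x : Fin (2 ^ m)) : flipLow (flipLow x) = x :=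
  Fin.ext (by rw [flipLow_val hm, flipLow_val hm, Nat.xor_xor_cancel_right])

/-- The parity of `flipLow x` is that of `x + 1` (`1 ≤ m`). [folklore] -/
theorem flipLow_val_mod_two (hm : 1 ≤ m) (x : Fin (2 ^ m)) :
    (flipLow x).val % 2 = (x.val + 1) % 2 := by
  rw [flipLow_val hm, Nat.xor_mod_two_eq]

/-- `flipLow` changes the parity (`1 ≤ m`). [folklore] -/
theorem flipLow_val_mod_two_ne (hm : 1 ≤ m) (x : Fin (2 ^ m)) :
    (flipLow x).val % 2 ≠ x.val % 2 := by
  rw [flipLow_val_mod_two hm]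
  omega

/-- `flipLow` has no fixed point (`1 ≤ m`). [folklore] -/
theorem flipLow_ne_self (hm : 1 ≤ m) (x : Fin (2 ^ m)) : flipLow x ≠ x := fun h =>
  flipLow_val_mod_two_ne hm x (by rw [h])

/-- `flipLow` is injective (`1 ≤ m`). [folklore] -/
theorem flipLow_injective (hm : 1 ≤ m) : Function.Injective (flipLow (m := m)) :=
  Function.Involutive.injective (flipLow_flipLow hm)

/-! ### Horizon truncation of the verifier table -/

/-- The HORIZON-TRUNCATED input: `horizonInput h t` agrees with `t` on the whole `S`-table and on
the `V`-cells of level `≤ h`, and reads `false` on every `V`-cell `(x, i)` with `i > h` (the marks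
beyond the horizon `h` are hidden). The oracle-modification device of a hybrid argument
(cf. Bennett–Bernstein–Brassard–Vazirani 1997, Thm. 3.3), specialised to the level structure of
SVL. [folklore] -/
def horizonInput (h : ℕ) (t : SVLInput m T) : SVLInput m T := fun k =>
  if ∃ x : Fin (2 ^ m), ∃ i : Fin (T + 1), k = svlVerifyIndex m T x i ∧ h < i.val then false
  else t k

/-- Truncation does not touch the `S`-table. [folklore] -/
@[simp] theorem horizonInput_apply_svlSuccIndex (h : ℕ) (t : SVLInput m T) (x : Fin (2 ^ m))
    (j : Fin m) : horizonInput h t (svlSuccIndex m T x j) = t (svlSuccIndex m T x j) := by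
  unfold horizonInput
  rw [if_neg]
  rintro ⟨x', i, hk, -⟩
  exact svlSuccIndex_ne_svlVerifyIndex _ _ _ _ hk

/-- Truncation at a `V`-cell: `false` beyond the horizon, unchanged inside it. [folklore] -/
theorem horizonInput_apply_svlVerifyIndex (h : ℕ) (t : SVLInput m T) (x : Fin (2 ^ m))
    (i : Fin (T + 1)) :
    horizonInput h t (svlVerifyIndex m T x i) =
      if h < i.val then false else t (svlVerifyIndex m T x i) := by
  unfold horizonInput
  by_cases hi : h < i.val
  · rw [if_pos ⟨x, i, rfl, hi⟩, if_pos hi]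
  · rw [if_neg, if_neg hi]
    rintro ⟨x', i', hk, hi'⟩
    obtain ⟨-, rfl⟩ := svlVerifyIndex_inj.1 hk
    exact hi hi'

/-- The `S`-table bits of the truncated input are those of `t`. [folklore] -/
@[simp] theorem svlSuccBit_horizonInput (h : ℕ) (t : SVLInput m T) (x : Fin (2 ^ m)) (j : Fin m) :
    svlSuccBit (horizonInput h t) x j = svlSuccBit t x j :=
  horizonInput_apply_svlSuccIndex h t x j

/-- The successor table of the truncated input is that of `t`. [folklore] -/
@[simp] theorem svlSucc_horizonInput (h : ℕ) (t : SVLInput m T) (x : Fin (2 ^ m)) :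
    svlSucc (horizonInput h t) x = svlSucc t x := by
  unfold svlSucc
  congr 1
  funext j
  exact svlSuccBit_horizonInput h t x j

/-- The verifier table of the truncated input: `false` beyond the horizon, `V` inside it.
[folklore] -/
@[simp] theorem svlVerify_horizonInput (h : ℕ) (t : SVLInput m T) (x : Fin (2 ^ m))
    (i : Fin (T + 1)) :
    svlVerify (horizonInput h t) x i = if h < i.val then false else svlVerify t x i :=
  horizonInput_apply_svlVerifyIndex h t x i

/-- With the horizon at or beyond the last level nothing is hidden. [folklore] -/
theorem horizonInput_eq_self (h : ℕ) (hT : T ≤ h) (t : SVLInput m T) : horizonInput h t = t := by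
  funext k
  unfold horizonInput
  rw [if_neg]
  rintro ⟨x, i, -, hi⟩
  have := i.isLt
  omega

/-- Truncations compose to the truncation at the nearer horizon. [folklore] -/
theorem horizonInput_horizonInput (h h' : ℕ) (t : SVLInput m T) :
    horizonInput h (horizonInput h' t) = horizonInput (min h h') t := by
  funext k
  rcases eq_svlSuccIndex_or_eq_svlVerifyIndex k with ⟨x, j, rfl⟩ | ⟨x, i, rfl⟩
  · simp only [horizonInput_apply_svlSuccIndex]
  · simp only [horizonInput_apply_svlVerifyIndex, min_lt_iff]
    by_cases h1 : h < i.val <;> by_cases h2 : h' < i.val <;> simp [h1, h2]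

/-- Relabelling commutes with truncation (relabelling acts on names, truncation on levels).
[folklore] -/
theorem horizonInput_svlRelabel (h : ℕ) (τ : Equiv.Perm (Fin (2 ^ m))) (t : SVLInput m T) :
    horizonInput h (svlRelabel τ t) = svlRelabel τ (horizonInput h t) := by
  funext k
  rcases eq_svlSuccIndex_or_eq_svlVerifyIndex k with ⟨x, j, rfl⟩ | ⟨x, i, rfl⟩
  · rw [horizonInput_apply_svlSuccIndex, apply_svlSuccIndex (svlRelabel τ t),
      apply_svlSuccIndex (svlRelabel τ (horizonInput h t)), svlSuccBit_svlRelabel,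
      svlSuccBit_svlRelabel, svlSucc_horizonInput]
  · rw [horizonInput_apply_svlVerifyIndex, apply_svlVerifyIndex (svlRelabel τ t),
      apply_svlVerifyIndex (svlRelabel τ (horizonInput h t)), svlVerify_svlRelabel,
      svlVerify_svlRelabel, svlVerify_horizonInput]

/-- On an input with verifiable line `xs`, truncating at horizon `h` FLIPS exactly the block of the
hidden marked cells `(x_i, i)`, `h < i ≤ T` (all other `V`-cells beyond the horizon already read
`false`): `horizonInput h t = t^B` with `B = {svlVerifyIndex m T (x_i) i | h < i}`, the form used
by the hybrid bound (`flipBlock`, `l2Norm'_oracle_sub_le`). [folklore] -/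
theorem IsSvlLine.horizonInput_eq_flipBlock {t : SVLInput m T} {xs : Fin (T + 1) → Fin (2 ^ m)}
    (ht : IsSvlLine t xs) (h : ℕ) :
    horizonInput h t = flipBlock t
      ((Finset.univ.filter fun i : Fin (T + 1) => h < i.val).image
        fun i => svlVerifyIndex m T (xs i) i) := by
  funext k
  rcases eq_svlSuccIndex_or_eq_svlVerifyIndex k with ⟨x, j, rfl⟩ | ⟨x, i, rfl⟩
  · rw [horizonInput_apply_svlSuccIndex, flipBlock_apply_of_not_mem]
    simp only [Finset.mem_image, Finset.mem_filter, Finset.mem_univ, true_and, not_exists,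
      not_and]
    intro i _ hk
    exact svlSuccIndex_ne_svlVerifyIndex _ _ _ _ hk.symm
  · rw [horizonInput_apply_svlVerifyIndex]
    by_cases hmem : svlVerifyIndex m T x i ∈
        (Finset.univ.filter fun i : Fin (T + 1) => h < i.val).image
          fun i => svlVerifyIndex m T (xs i) i
    · rw [flipBlock_apply_of_mem hmem]
      obtain ⟨i', hi', hk⟩ := Finset.mem_image.1 hmem
      obtain ⟨hx, rfl⟩ := svlVerifyIndex_inj.1 hk
      simp only [Finset.mem_filter, Finset.mem_univ, true_and] at hi'
      have hv : t (svlVerifyIndex m T x i') = true := ht.svlVerify_eq_true_iff.2 hx.symm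
      rw [if_pos hi', hv]
      rfl
    · rw [flipBlock_apply_of_not_mem hmem]
      by_cases hi : h < i.val
      · have hx : x ≠ xs i := fun hx =>
          hmem (Finset.mem_image.2 ⟨i, by simp [hi], by rw [hx]⟩)
        have hv : t (svlVerifyIndex m T x i) = false :=
          Bool.eq_false_iff.2 fun h' => hx (ht.svlVerify_eq_true_iff.1 h')
        rw [if_pos hi, hv]
      · rw [if_neg hi]

/-- Membership in the hidden block: the cell `(x, i)` is flipped iff `i > h` and `x = x_i`.
[folklore] -/
theorem svlVerifyIndex_mem_horizonBlock_iff {xs : Fin (T + 1) → Fin (2 ^ m)} {h : ℕ}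
    {x : Fin (2 ^ m)} {i : Fin (T + 1)} :
    svlVerifyIndex m T x i ∈ ((Finset.univ.filter fun i : Fin (T + 1) => h < i.val).image
        fun i => svlVerifyIndex m T (xs i) i) ↔ h < i.val ∧ x = xs i := by
  simp only [Finset.mem_image, Finset.mem_filter, Finset.mem_univ, true_and]
  constructor
  · rintro ⟨i', hi', hk⟩
    obtain ⟨hx, rfl⟩ := svlVerifyIndex_inj.1 hk
    exact ⟨hi', hx.symm⟩
  · rintro ⟨hi, rfl⟩
    exact ⟨i, hi, rfl⟩

/-- The hidden block has `T - h` cells (levels `h + 1, …, T`; none if `T ≤ h`). [folklore] -/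
theorem card_horizonBlock {xs : Fin (T + 1) → Fin (2 ^ m)} (h : ℕ) :
    ((Finset.univ.filter fun i : Fin (T + 1) => h < i.val).image
        fun i => svlVerifyIndex m T (xs i) i).card = T - h := by
  rw [Finset.card_image_of_injective _ fun i i' hii' => (svlVerifyIndex_inj.1 hii').2]
  by_cases hT : h ≤ T
  · have heq : (Finset.univ.filter fun i : Fin (T + 1) => h < i.val) =
        Finset.Ioi (⟨h, Nat.lt_succ_of_le hT⟩ : Fin (T + 1)) := by
      ext i
      simp [Fin.lt_def]
    rw [heq, Fin.card_Ioi]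
    dsimp only
    omega
  · have heq : (Finset.univ.filter fun i : Fin (T + 1) => h < i.val) = ∅ :=
      Finset.filter_eq_empty_iff.2 fun i _ hi => hT (by have := i.isLt; omega)
    rw [heq, Finset.card_empty]
    omega

end MergeFree

end Literature.Computability.QuantumComplexity
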